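import Mathlib
import Summits.Ventures.PercRepro2.Defs
import Summits.Ventures.PercRepro2.Harris
import Summits.Ventures.PercRepro2.CoinDefs
import Summits.Ventures.PercRepro2.CoinReverse
import Summits.Ventures.PercRepro2.CoinLsmCoreDefs
import Summits.Ventures.PercRepro2.CoinLsmCoreU
import Summits.Ventures.PercRepro2.CoinSquareCoreDefs

/-!
# The directed diamond core (blind cell PercRepro2, night-2 g8; proofs/NIGHT2-DARC.md §32)

`DiamondCore arcs s p q a c₁ c₂ c₃ c₄`: the four single-arc coins `c₁ = s → p`, `c₂ = s → q`,
`c₃ = p → a`, `c₄ = q → a` are the ONLY coins with an arc into `{s, p, q, a}`.  The core is closed in,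
reachability is `s ⇝ p ⟺ α`, `s ⇝ q ⟺ β`, `s ⇝ a ⟺ αγ ∨ βδ`, and the core levels are unions of
the cylinders of the four coins (`prob_level`), giving `ν(∅) = (1−α)(1−β)`, `ν({p}) = α(1−β)(1−γ)`,
`ν({q}) = (1−α)β(1−δ)`, `ν({p,q}) = αβ(1−γ)(1−δ)`, `ν({a}) = 0`, `ν({p,a}) = α(1−β)γ`,
`ν({q,a}) = (1−α)βδ`, `ν({p,q,a}) = αβ(γ + δ − γδ)`.
-/

namespace Summit.Ventures.PercRepro2.Coin

open Classical

section DiamondCoreDefs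

variable {V : Type*} {E : Type*} [DecidableEq V]

/-- The directed diamond core `s → p → a ← q ← s`: four single-arc coins and «no other coin enters
`{s, p, q, a}`». -/
structure DiamondCore (arcs : E → Finset (V × V)) (s p q a : V) (c₁ c₂ c₃ c₄ : E) : Prop where
  arc₁ : arcs c₁ = {(s, p)}
  arc₂ : arcs c₂ = {(s, q)}
  arc₃ : arcs c₃ = {(p, a)}
  arc₄ : arcs c₄ = {(q, a)}
  core : ∀ e, ∀ xy ∈ arcs e, (xy.2 = s ∨ xy.2 = p ∨ xy.2 = q ∨ xy.2 = a) →
    e = c₁ ∨ e = c₂ ∨ e = c₃ ∨ e = c₄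
  sp : s ≠ p
  sq : s ≠ q
  sa : s ≠ a
  pq : p ≠ q
  pa : p ≠ a
  qa : q ≠ a

variable {arcs : E → Finset (V × V)} {s p q a : V} {c₁ c₂ c₃ c₄ : E}

/-- The diamond core is closed in. -/
theorem DiamondCore.closedInCoreU (h : DiamondCore arcs s p q a c₁ c₂ c₃ c₄) :
    ClosedInCoreU arcs s {p, q, a} := by
  refine ⟨?_, ?_, ?_⟩
  · intro e xy hxy hy
    simp only [Finset.mem_insert, Finset.mem_singleton] at hy
    have hc := h.core e xy hxy (by tauto)
    simp only [Finset.mem_insert, Finset.mem_singleton]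
    rcases hc with rfl | rfl | rfl | rfl
    · rw [h.arc₁, Finset.mem_singleton] at hxy; subst hxy; simp
    · rw [h.arc₂, Finset.mem_singleton] at hxy; subst hxy; simp
    · rw [h.arc₃, Finset.mem_singleton] at hxy; subst hxy; simp
    · rw [h.arc₄, Finset.mem_singleton] at hxy; subst hxy; simp
  · intro e xy hxy hy
    have hc := h.core e xy hxy (Or.inl hy)
    exfalso
    rcases hc with rfl | rfl | rfl | rfl
    · rw [h.arc₁, Finset.mem_singleton] at hxy; subst hxy; exact h.sp hy.symm
    · rw [h.arc₂, Finset.mem_singleton] at hxy; subst hxy; exact h.sq hy.symm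
    · rw [h.arc₃, Finset.mem_singleton] at hxy; subst hxy; exact h.sa hy.symm
    · rw [h.arc₄, Finset.mem_singleton] at hxy; subst hxy; exact h.sa hy.symm
  · simp only [Finset.mem_insert, Finset.mem_singleton, not_or]
    exact ⟨h.sp, h.sq, h.sa⟩

omit [DecidableEq V] in
/-- The closure lemma of the diamond: if `Z ⊆ {p, q, a}` and no OPEN coin carries an arc from
outside `Z` into `Z`, nothing reachable from `s` lies in `Z`. -/
lemma DiamondCore.not_reach_of_closed (h : DiamondCore arcs s p q a c₁ c₂ c₃ c₄) {ω : Config E}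
    {Z : Set V} (hZs : s ∉ Z) (hZ : ∀ v ∈ Z, v = p ∨ v = q ∨ v = a)
    (h₁ : ω c₁ = true → p ∈ Z → s ∈ Z) (h₂ : ω c₂ = true → q ∈ Z → s ∈ Z)
    (h₃ : ω c₃ = true → a ∈ Z → p ∈ Z) (h₄ : ω c₄ = true → a ∈ Z → q ∈ Z)
    {y : V} (hy : y ∈ Z) : ¬ Reach arcs ω s y := by
  intro hr
  have key := reach_mem_of_closed (U := Zᶜ) ?_ hZs hr
  · exact key hy
  · intro e he xy hxy hx hy'
    have hc := h.core e xy hxy (by rcases hZ _ hy' with h' | h' | h' <;> simp [h'])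
    rcases hc with rfl | rfl | rfl | rfl
    · rw [h.arc₁, Finset.mem_singleton] at hxy; subst hxy; exact hx (h₁ he hy')
    · rw [h.arc₂, Finset.mem_singleton] at hxy; subst hxy; exact hx (h₂ he hy')
    · rw [h.arc₃, Finset.mem_singleton] at hxy; subst hxy; exact hx (h₃ he hy')
    · rw [h.arc₄, Finset.mem_singleton] at hxy; subst hxy; exact hx (h₄ he hy')

omit [DecidableEq V] in
/-- `s ⇝ p` iff `α` is open. -/
theorem DiamondCore.reach_p_iff (h : DiamondCore arcs s p q a c₁ c₂ c₃ c₄) (ω : Config E) :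
    Reach arcs ω s p ↔ ω c₁ = true := by
  constructor
  · intro hr
    by_cases hb1 : ω c₁ = true
    · exact hb1
    simp only [Bool.not_eq_true] at hb1
    exfalso
    refine h.not_reach_of_closed (Z := {v | v = p}) (by simp [h.sp]) (by simp) ?_ ?_ ?_ ?_ (by simp) hr
    · intro h'; simp [hb1] at h'
    · intro _ h'; simp [h.pq.symm] at h'
    · intro _ h'; simp [h.pa.symm] at h'
    · intro _ h'; simp [h.pa.symm] at h'
  · intro h1
    exact reach_of_openArc ⟨c₁, h1, by rw [h.arc₁]; simp⟩

omit [DecidableEq V] in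
/-- `s ⇝ q` iff `β` is open. -/
theorem DiamondCore.reach_q_iff (h : DiamondCore arcs s p q a c₁ c₂ c₃ c₄) (ω : Config E) :
    Reach arcs ω s q ↔ ω c₂ = true := by
  constructor
  · intro hr
    by_cases hb2 : ω c₂ = true
    · exact hb2
    simp only [Bool.not_eq_true] at hb2
    exfalso
    refine h.not_reach_of_closed (Z := {v | v = q}) (by simp [h.sq]) (by simp) ?_ ?_ ?_ ?_ (by simp) hr
    · intro _ h'; simp [h.pq] at h'
    · intro h'; simp [hb2] at h'
    · intro _ h'; simp [h.qa.symm] at h'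
    · intro _ h'; simp [h.qa.symm] at h'
  · intro h2
    exact reach_of_openArc ⟨c₂, h2, by rw [h.arc₂]; simp⟩

omit [DecidableEq V] in
/-- `s ⇝ a` iff the route `α, γ` or the route `β, δ` is open. -/
theorem DiamondCore.reach_a_iff (h : DiamondCore arcs s p q a c₁ c₂ c₃ c₄) (ω : Config E) :
    Reach arcs ω s a ↔ (ω c₁ = true ∧ ω c₃ = true) ∨ (ω c₂ = true ∧ ω c₄ = true) := by
  constructor
  · intro hr
    by_cases h13 : ω c₁ = true ∧ ω c₃ = true
    · exact Or.inl h13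
    by_cases h24 : ω c₂ = true ∧ ω c₄ = true
    · exact Or.inr h24
    exfalso
    by_cases hb1 : ω c₁ = true
    · have hb3 : ω c₃ = false := by
        cases hc : ω c₃
        · rfl
        · exact absurd ⟨hb1, hc⟩ h13
      by_cases hb2 : ω c₂ = true
      · have hb4 : ω c₄ = false := by
          cases hc : ω c₄
          · rfl
          · exact absurd ⟨hb2, hc⟩ h24
        refine h.not_reach_of_closed (Z := {v | v = a}) (by simp [h.sa]) (by simp) ?_ ?_ ?_ ?_
          (by simp) hr
        · intro _ h'; simp [h.pa] at h'
        · intro _ h'; simp [h.qa] at h'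
        · intro h'; simp [hb3] at h'
        · intro h'; simp [hb4] at h'
      · simp only [Bool.not_eq_true] at hb2
        refine h.not_reach_of_closed (Z := {v | v = q ∨ v = a}) (by simp [h.sq, h.sa]) (by simp)
          ?_ ?_ ?_ ?_ (by simp) hr
        · intro _ h'; simp [h.pq, h.pa] at h'
        · intro h'; simp [hb2] at h'
        · intro h'; simp [hb3] at h'
        · intro _ _; simp
    · simp only [Bool.not_eq_true] at hb1
      by_cases hb2 : ω c₂ = true
      · have hb4 : ω c₄ = false := by
          cases hc : ω c₄
          · rfl
          · exact absurd ⟨hb2, hc⟩ h24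
        refine h.not_reach_of_closed (Z := {v | v = p ∨ v = a}) (by simp [h.sp, h.sa]) (by simp)
          ?_ ?_ ?_ ?_ (by simp) hr
        · intro h'; simp [hb1] at h'
        · intro _ h'; simp [h.pq.symm, h.qa] at h'
        · intro _ _; simp
        · intro h'; simp [hb4] at h'
      · simp only [Bool.not_eq_true] at hb2
        refine h.not_reach_of_closed (Z := {v | v = p ∨ v = q ∨ v = a})
          (by simp [h.sp, h.sq, h.sa]) (by simp) ?_ ?_ ?_ ?_ (by simp) hr
        · intro h'; simp [hb1] at h'
        · intro h'; simp [hb2] at h'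
        · intro _ _; simp
        · intro _ _; simp
  · rintro (⟨h1, h3⟩ | ⟨h2, h4⟩)
    · have r1 : Reach arcs ω s p := reach_of_openArc ⟨c₁, h1, by rw [h.arc₁]; simp⟩
      have r2 : Reach arcs ω p a := reach_of_openArc ⟨c₃, h3, by rw [h.arc₃]; simp⟩
      exact reach_trans r1 r2
    · have r1 : Reach arcs ω s q := reach_of_openArc ⟨c₂, h2, by rw [h.arc₂]; simp⟩
      have r2 : Reach arcs ω q a := reach_of_openArc ⟨c₄, h4, by rw [h.arc₄]; simp⟩
      exact reach_trans r1 r2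

end DiamondCoreDefs

section DiamondLevels

variable {V : Type*} {E : Type*} [DecidableEq V] [Fintype E] [DecidableEq E]
  {R : Type*} [Field R]
  {arcs : E → Finset (V × V)} {s p q a : V} {c₁ c₂ c₃ c₄ : E}

omit [Fintype E] [DecidableEq E] in
/-- On the cylinder of `b`, membership in the core level of `W` is the Boolean condition
`(p ∈ W ↔ b₁) ∧ (q ∈ W ↔ b₂) ∧ (a ∈ W ↔ b₁ b₃ ∨ b₂ b₄)`. -/
lemma DiamondCore.level_inter_cyl (h : DiamondCore arcs s p q a c₁ c₂ c₃ c₄) (W : Finset V)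
    (b : Bool × Bool × Bool × Bool) :
    coreLevel arcs s {p, q, a} W ∩ {ω | ω c₁ = b.1 ∧ ω c₂ = b.2.1 ∧ ω c₃ = b.2.2.1 ∧ ω c₄ = b.2.2.2}
      = if (p ∈ W ↔ b.1 = true) ∧ (q ∈ W ↔ b.2.1 = true) ∧
          (a ∈ W ↔ ((b.1 = true ∧ b.2.2.1 = true) ∨ (b.2.1 = true ∧ b.2.2.2 = true)))
        then {ω | ω c₁ = b.1 ∧ ω c₂ = b.2.1 ∧ ω c₃ = b.2.2.1 ∧ ω c₄ = b.2.2.2} else ∅ := by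
  obtain ⟨b₁, b₂, b₃, b₄⟩ := b
  ext ω
  have hmem : ω ∈ coreLevel arcs s {p, q, a} W ↔
      (p ∈ W ↔ ω c₁ = true) ∧ (q ∈ W ↔ ω c₂ = true) ∧
        (a ∈ W ↔ ((ω c₁ = true ∧ ω c₃ = true) ∨ (ω c₂ = true ∧ ω c₄ = true))) := by
    rw [mem_coreLevel]
    simp only [Finset.mem_insert, Finset.mem_singleton, forall_eq_or_imp, forall_eq,
      h.reach_p_iff, h.reach_q_iff, h.reach_a_iff]
  simp only [Set.mem_inter_iff, hmem, Set.mem_setOf_eq]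
  split_ifs with hc
  · simp only [Set.mem_setOf_eq]
    constructor
    · rintro ⟨_, hω⟩; exact hω
    · rintro ⟨h1, h2, h3, h4⟩
      refine ⟨?_, h1, h2, h3, h4⟩
      rw [h1, h2, h3, h4]; exact hc
  · simp only [Set.mem_empty_iff_false, iff_false]
    rintro ⟨hW, h1, h2, h3, h4⟩
    rw [h1, h2, h3, h4] at hW
    exact hc hW

/-- The core level probabilities of the diamond as a sum over the `16` coin configurations. -/
theorem DiamondCore.prob_level (h : DiamondCore arcs s p q a c₁ c₂ c₃ c₄) (pr : E → R)
    (h12 : c₁ ≠ c₂) (h13 : c₁ ≠ c₃) (h14 : c₁ ≠ c₄) (h23 : c₂ ≠ c₃) (h24 : c₂ ≠ c₄) (h34 : c₃ ≠ c₄)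
    (W : Finset V) :
    prob pr (coreLevel arcs s {p, q, a} W) = ∑ b : Bool × Bool × Bool × Bool,
      if (p ∈ W ↔ b.1 = true) ∧ (q ∈ W ↔ b.2.1 = true) ∧
          (a ∈ W ↔ ((b.1 = true ∧ b.2.2.1 = true) ∨ (b.2.1 = true ∧ b.2.2.2 = true)))
        then edgeFactor (pr c₁) b.1 * edgeFactor (pr c₂) b.2.1 * edgeFactor (pr c₃) b.2.2.1 *
          edgeFactor (pr c₄) b.2.2.2 else 0 := by
  rw [prob_eq_sum_cyl4 (c₁ := c₁) (c₂ := c₂) (c₃ := c₃) (c₄ := c₄)]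
  refine Finset.sum_congr rfl fun b _ => ?_
  rw [h.level_inter_cyl W b]
  split_ifs
  · exact prob_cyl4 pr h12 h13 h14 h23 h24 h34 b
  · simp [prob]

/-- `ν(∅) = (1 − α)(1 − β)`. -/
theorem DiamondCore.nu_empty (h : DiamondCore arcs s p q a c₁ c₂ c₃ c₄) (pr : E → R)
    (h12 : c₁ ≠ c₂) (h13 : c₁ ≠ c₃) (h14 : c₁ ≠ c₄) (h23 : c₂ ≠ c₃) (h24 : c₂ ≠ c₄) (h34 : c₃ ≠ c₄) :
    prob pr (coreLevel arcs s {p, q, a} ∅) = (1 - pr c₁) * (1 - pr c₂) := by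
  rw [h.prob_level pr h12 h13 h14 h23 h24 h34]
  simp [Fintype.sum_prod_type]
  ring

/-- `ν({p}) = α(1 − β)(1 − γ)`. -/
theorem DiamondCore.nu_p (h : DiamondCore arcs s p q a c₁ c₂ c₃ c₄) (pr : E → R)
    (h12 : c₁ ≠ c₂) (h13 : c₁ ≠ c₃) (h14 : c₁ ≠ c₄) (h23 : c₂ ≠ c₃) (h24 : c₂ ≠ c₄) (h34 : c₃ ≠ c₄) :
    prob pr (coreLevel arcs s {p, q, a} {p}) = pr c₁ * (1 - pr c₂) * (1 - pr c₃) := by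
  rw [h.prob_level pr h12 h13 h14 h23 h24 h34]
  simp [Fintype.sum_prod_type, h.pq.symm, h.pa.symm]
  ring

/-- `ν({q}) = (1 − α)β(1 − δ)`. -/
theorem DiamondCore.nu_q (h : DiamondCore arcs s p q a c₁ c₂ c₃ c₄) (pr : E → R)
    (h12 : c₁ ≠ c₂) (h13 : c₁ ≠ c₃) (h14 : c₁ ≠ c₄) (h23 : c₂ ≠ c₃) (h24 : c₂ ≠ c₄) (h34 : c₃ ≠ c₄) :
    prob pr (coreLevel arcs s {p, q, a} {q}) = (1 - pr c₁) * pr c₂ * (1 - pr c₄) := by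
  rw [h.prob_level pr h12 h13 h14 h23 h24 h34]
  simp [Fintype.sum_prod_type, h.pq, h.qa.symm]
  ring

/-- `ν({p, q}) = αβ(1 − γ)(1 − δ)`. -/
theorem DiamondCore.nu_pq (h : DiamondCore arcs s p q a c₁ c₂ c₃ c₄) (pr : E → R)
    (h12 : c₁ ≠ c₂) (h13 : c₁ ≠ c₃) (h14 : c₁ ≠ c₄) (h23 : c₂ ≠ c₃) (h24 : c₂ ≠ c₄) (h34 : c₃ ≠ c₄) :
    prob pr (coreLevel arcs s {p, q, a} {p, q}) = pr c₁ * pr c₂ * (1 - pr c₃) * (1 - pr c₄) := by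
  rw [h.prob_level pr h12 h13 h14 h23 h24 h34]
  simp [Fintype.sum_prod_type, h.pa.symm, h.qa.symm]

/-- `ν({a}) = 0`. -/
theorem DiamondCore.nu_a (h : DiamondCore arcs s p q a c₁ c₂ c₃ c₄) (pr : E → R)
    (h12 : c₁ ≠ c₂) (h13 : c₁ ≠ c₃) (h14 : c₁ ≠ c₄) (h23 : c₂ ≠ c₃) (h24 : c₂ ≠ c₄) (h34 : c₃ ≠ c₄) :
    prob pr (coreLevel arcs s {p, q, a} {a}) = 0 := by
  rw [h.prob_level pr h12 h13 h14 h23 h24 h34]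
  simp [Fintype.sum_prod_type, h.pa, h.qa]

/-- `ν({p, a}) = α(1 − β)γ`. -/
theorem DiamondCore.nu_pa (h : DiamondCore arcs s p q a c₁ c₂ c₃ c₄) (pr : E → R)
    (h12 : c₁ ≠ c₂) (h13 : c₁ ≠ c₃) (h14 : c₁ ≠ c₄) (h23 : c₂ ≠ c₃) (h24 : c₂ ≠ c₄) (h34 : c₃ ≠ c₄) :
    prob pr (coreLevel arcs s {p, q, a} {p, a}) = pr c₁ * (1 - pr c₂) * pr c₃ := by
  rw [h.prob_level pr h12 h13 h14 h23 h24 h34]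
  simp [Fintype.sum_prod_type, h.pq.symm, h.qa]
  ring

/-- `ν({q, a}) = (1 − α)βδ`. -/
theorem DiamondCore.nu_qa (h : DiamondCore arcs s p q a c₁ c₂ c₃ c₄) (pr : E → R)
    (h12 : c₁ ≠ c₂) (h13 : c₁ ≠ c₃) (h14 : c₁ ≠ c₄) (h23 : c₂ ≠ c₃) (h24 : c₂ ≠ c₄) (h34 : c₃ ≠ c₄) :
    prob pr (coreLevel arcs s {p, q, a} {q, a}) = (1 - pr c₁) * pr c₂ * pr c₄ := by
  rw [h.prob_level pr h12 h13 h14 h23 h24 h34]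
  simp [Fintype.sum_prod_type, h.pq, h.pa]
  ring

/-- `ν({p, q, a}) = αβ(γ + δ − γδ)`. -/
theorem DiamondCore.nu_pqa (h : DiamondCore arcs s p q a c₁ c₂ c₃ c₄) (pr : E → R)
    (h12 : c₁ ≠ c₂) (h13 : c₁ ≠ c₃) (h14 : c₁ ≠ c₄) (h23 : c₂ ≠ c₃) (h24 : c₂ ≠ c₄) (h34 : c₃ ≠ c₄) :
    prob pr (coreLevel arcs s {p, q, a} {p, q, a}) = pr c₁ * pr c₂ * (pr c₃ + pr c₄ - pr c₃ * pr c₄) := by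
  rw [h.prob_level pr h12 h13 h14 h23 h24 h34]
  simp [Fintype.sum_prod_type]
  ring

end DiamondLevels

end Summit.Ventures.PercRepro2.Coin
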